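import Literature.NumberTheory.GaloisRepresentations.GaloisRepOfLadicLimit
import HarnessLib

/-!
# Semisimple representations as `ℓ`-adic TRACE limits (Taylor's pseudo-representation argument)

Stub `stub_traceLimit` (S1) of the line `slope-free-polarized-limit` for the crux
`Summit.Langlands.Langlands.Theses.PicardMuOrdinary.IrregularClassicality`.

Let `G` be a topological group, `ℓ` a prime, `E ⊆ ℚ̄_ℓ` a finite extension of `ℚ_ℓ`, `D ⊆ G` dense,
`t : G → ℚ̄_ℓ` a target which is `E`-valued on `D`, `I ⊆ G` a set of elements and
`ρ'_m : G → GL_n(ℚ̄_ℓ)` (`m ≥ 0`) continuous representations with `ρ'_m(τ) = 1` for `τ ∈ I` and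
`‖tr ρ'_m(g) - t(g)‖ ≤ ℓ^{-m}` for `g ∈ D`.  Then there is a continuous SEMISIMPLE
`ρ : G → GL_n(ℚ̄_ℓ)` with `ρ(τ) = 1` for `τ ∈ I`, `‖tr ρ'_m - tr ρ‖ ≤ ℓ^{-m}` on all of `G`, and
`E`-valued trace (`exists_semisimple_framedRep_of_traceLimit`; closed `∀`-form `stub_traceLimit`).

This is the trace form of the tree's `exists_semisimple_galoisRep_of_ladicLimit`
(`Literature/NumberTheory/GaloisRepresentations/GaloisRepOfLadicLimit.lean`), i.e. Taylor 1991 §1 /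
Goldring–Koskivirta 2019 §11.1:

1. the traces `tr ρ'_m` are continuous and uniformly Cauchy on the dense `D`, hence converge
   uniformly to a continuous `E`-valued `F` (`LadicLimit.exists_continuous_limit_of_dense`);
2. a pointwise limit of the pseudocharacters `tr ρ'_m` (`Rouquier1996_prop_3_1_trace_holds`) is a
   pseudocharacter of dimension `n` (`IsPseudocharacter.of_tendsto`);
3. Taylor's theorem in the continuous form of Bellaïche–Chenevier
   (`BellaicheChenevier2009_continuous_rep_of_pseudocharacter_holds`): `F = tr ρ`, `ρ` semisimple;
4. for `τ ∈ I`, `F(gτ) = F(g)` (limits of `tr ρ'_m(gτ) = tr ρ'_m(g)`), so `τ` may be deleted from any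
   product inside `tr ρ` ("cyclic stripping"), whence `tr ρ((gτ)^j) = tr ρ(g^j)` for all `j`; traces
   of powers determine the characteristic polynomial in characteristic `0` (Newton,
   `LadicLimit.matrix_trace_pow_eq_sum_roots_pow`, `LadicLimit.multiset_eq_of_psum_eq`), so `τ`
   lies in the characteristic-polynomial kernel of the semisimple `ρ`, which is `ker ρ`
   (`Automorphic.apply_eq_one_of_mem_charpolyKer`).
-/

open Literature.NumberTheory.GaloisRepresentations Literature.NumberTheory.Automorphic
open Filter Topology Polynomial

set_option linter.dupNamespace false -- project-wide option (lakefile weak.linter.dupNamespace); `Summit.Langlands.Langlands` is the mandated namespace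
set_option autoImplicit false

namespace Summit.Langlands.Langlands.Theorems.IrregularClassicality.SlopeFreePolarizedLimit

noncomputable section

/-- **Traces of powers determine the characteristic polynomial** (characteristic `0`,
algebraically closed): if `tr(A^j) = tr(B^j)` for all `j` then `χ_A = χ_B` (power sums of the
roots agree, Newton's identities). -/
theorem charpoly_eq_of_trace_pow_eq {F : Type*} [Field F] [IsAlgClosed F] [CharZero F] {n : ℕ}
    (A B : Matrix (Fin n) (Fin n) F) (h : ∀ j : ℕ, (A ^ j).trace = (B ^ j).trace) :
    A.charpoly = B.charpoly := by
  classical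
  have hAm : A.charpoly.Monic := Matrix.charpoly_monic A
  have hBm : B.charpoly.Monic := Matrix.charpoly_monic B
  have hAd : A.charpoly.natDegree = n := by
    rw [Matrix.charpoly_natDegree_eq_dim, Fintype.card_fin]
  have hBd : B.charpoly.natDegree = n := by
    rw [Matrix.charpoly_natDegree_eq_dim, Fintype.card_fin]
  have hAr : Multiset.card A.charpoly.roots = n := by
    rw [splits_iff_card_roots.1 (IsAlgClosed.splits _), hAd]
  have hBr : Multiset.card B.charpoly.roots = n := by
    rw [splits_iff_card_roots.1 (IsAlgClosed.splits _), hBd]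
  have hroots : A.charpoly.roots = B.charpoly.roots :=
    LadicLimit.multiset_eq_of_psum_eq hAr hBr fun j _ _ => by
      rw [← LadicLimit.matrix_trace_pow_eq_sum_roots_pow,
        ← LadicLimit.matrix_trace_pow_eq_sum_roots_pow, h j]
  rw [← prod_multiset_X_sub_C_of_monic_of_roots_card_eq hAm (by rw [hAr, hAd]), hroots,
    prod_multiset_X_sub_C_of_monic_of_roots_card_eq hBm (by rw [hBr, hBd])]

/-- **Cyclic stripping.**  If a central function `T` on a monoid (`T(xy) = T(yx)`) satisfies
`T(gτ) = T(g)` for all `g`, then `T((gτ)^j y) = T(g^j y)` for all `g, y, j`; in particular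
`T((gτ)^j) = T(g^j)`. -/
theorem central_apply_mul_pow_eq {M : Type*} [Monoid M] {A : Type*} (T : M → A)
    (hc : ∀ x y : M, T (x * y) = T (y * x)) {τ : M} (hτ : ∀ g : M, T (g * τ) = T g) (g : M)
    (j : ℕ) (y : M) : T ((g * τ) ^ j * y) = T (g ^ j * y) := by
  -- `τ` may be deleted anywhere: `T(x τ y) = T(y x τ) = T(y x) = T(x y)`
  have hdel : ∀ x y : M, T (x * τ * y) = T (x * y) := fun x y => by
    rw [hc, ← mul_assoc, hτ, hc]
  induction j generalizing y with
  | zero => simp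
  | succ i ih =>
    rw [pow_succ, mul_assoc, ih, ← mul_assoc, ← mul_assoc, hdel, ← pow_succ]

variable {ℓ : ℕ} [Fact ℓ.Prime]

/-- **Semisimple representations as `ℓ`-adic trace limits** (Taylor 1991, §1 and proof of Thm. 2;
Goldring–Koskivirta 2019, §11.1).  `G` a topological group, `E ⊆ ℚ̄_ℓ` finite over `ℚ_ℓ`,
`D ⊆ G` dense, `t` an `E`-valued target on `D`, `I ⊆ G`, and `ρ'_m : G →ₜ* GL_n(ℚ̄_ℓ)` with
`ρ'_m(τ) = 1` (`τ ∈ I`) and `‖tr ρ'_m(g) - t(g)‖ ≤ ℓ^{-m}` (`g ∈ D`).  Then there is a continuous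
semisimple `ρ : G →ₜ* GL_n(ℚ̄_ℓ)` with `ρ(τ) = 1` for `τ ∈ I`, `‖tr ρ'_m(g) - tr ρ(g)‖ ≤ ℓ^{-m}`
for all `m, g`, and `tr ρ(g) ∈ E` for all `g`.  Proof: module docstring. -/
theorem exists_semisimple_framedRep_of_traceLimit {G : Type*} [Group G] [TopologicalSpace G]
    [IsTopologicalGroup G] (n : ℕ) (E : IntermediateField ℚ_[ℓ] (PadicAlgCl ℓ))
    [FiniteDimensional ℚ_[ℓ] E] {D : Set G} (hD : Dense D) (t : G → PadicAlgCl ℓ)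
    (ht : ∀ g ∈ D, t g ∈ E) (I : Set G) (ρ' : ℕ → FramedRep G (PadicAlgCl ℓ) n)
    (hI : ∀ m : ℕ, ∀ τ ∈ I, ρ' m τ = 1)
    (happ : ∀ m : ℕ, ∀ g ∈ D, ‖FramedRep.trace (ρ' m) g - t g‖ ≤ (ℓ : ℝ) ^ (-(m : ℤ))) :
    ∃ ρ : FramedRep G (PadicAlgCl ℓ) n,
      (FramedRep.toRepresentation ρ).IsSemisimpleRepresentation ∧
      (∀ τ ∈ I, ρ τ = 1) ∧
      (∀ (m : ℕ) (g : G), ‖FramedRep.trace (ρ' m) g - FramedRep.trace ρ g‖ ≤ (ℓ : ℝ) ^ (-(m : ℤ))) ∧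
      (∀ g : G, FramedRep.trace ρ g ∈ E) := by
  classical
  -- Step 1: the uniform limit `F` of the traces
  obtain ⟨F, hFc, hFE, hFbd, -⟩ :=
    LadicLimit.exists_continuous_limit_of_dense hD E (fun m => FramedRep.trace (ρ' m))
      (fun m => FramedRep.continuous_trace _) t ht happ
  have hlim : ∀ g, Tendsto (fun m => FramedRep.trace (ρ' m) g) atTop (𝓝 (F g)) := fun g =>
    tendsto_iff_norm_sub_tendsto_zero.2
      (squeeze_zero (fun m => norm_nonneg _) (fun m => hFbd m g) LadicLimit.tendsto_zpow_neg_natCast)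
  have hTlim : Tendsto (fun m => FramedRep.trace (ρ' m)) atTop (𝓝 F) := tendsto_pi_nhds.2 hlim
  -- Step 2: `F` is a continuous `E`-valued pseudocharacter of dimension `n`
  have hps : IsPseudocharacter F n :=
    IsPseudocharacter.of_tendsto (l := atTop)
      (Eventually.of_forall fun m =>
        Rouquier1996_prop_3_1_trace_holds G (PadicAlgCl ℓ) n ((ρ' m).toMonoidHom)) hTlim
  -- Step 3: Taylor's theorem
  let Tc : ContinuousPseudocharacter G (PadicAlgCl ℓ) n := ⟨F, hps, hFc⟩
  obtain ⟨ρ, hss, htr, -⟩ :=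
    BellaicheChenevier2009_continuous_rep_of_pseudocharacter_holds G ℓ n E
      ‹FiniteDimensional ℚ_[ℓ] E› Tc (fun g => hFE g)
  have htrF : ∀ g, FramedRep.trace ρ g = F g := htr
  refine ⟨ρ, hss, fun τ hτ => ?_, fun m g => by rw [htrF]; exact hFbd m g,
    fun g => by rw [htrF]; exact hFE g⟩
  -- Step 4: `ρ(τ) = 1` for `τ ∈ I`
  have hFinv : ∀ g, F (g * τ) = F g := fun g => by
    have e : ∀ m, FramedRep.trace (ρ' m) (g * τ) = FramedRep.trace (ρ' m) g := fun m => by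
      simp only [FramedRep.trace, map_mul, hI m τ hτ, mul_one]
    exact tendsto_nhds_unique (hlim (g * τ)) (by simp_rw [e]; exact hlim g)
  have hcent : ∀ x y : G, FramedRep.trace ρ (x * y) = FramedRep.trace ρ (y * x) := fun x y => by
    rw [htrF, htrF]; exact hps.map_mul_comm x y
  have hinv : ∀ g, FramedRep.trace ρ (g * τ) = FramedRep.trace ρ g := fun g => by
    rw [htrF, htrF, hFinv]
  have hpow : ∀ (g : G) (j : ℕ), FramedRep.trace ρ ((g * τ) ^ j) = FramedRep.trace ρ (g ^ j) :=
    fun g j => by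
      simpa using central_apply_mul_pow_eq (FramedRep.trace ρ) hcent hinv g j 1
  have hmat : ∀ (x : G) (j : ℕ), FramedRep.trace ρ (x ^ j) =
      (((ρ x : GL (Fin n) (PadicAlgCl ℓ)) : Matrix (Fin n) (Fin n) (PadicAlgCl ℓ)) ^ j).trace :=
    fun x j => by rw [FramedRep.trace, map_pow, Units.val_pow_eq_pow_val]
  have hcharpoly : ∀ g, FramedRep.charpoly ρ (g * τ) = FramedRep.charpoly ρ g := fun g =>
    charpoly_eq_of_trace_pow_eq _ _ fun j => by rw [← hmat, ← hmat, hpow]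
  have e : ∀ h : G, (FramedRep.toRepresentation ρ h).charpoly = FramedRep.charpoly ρ h := fun h => by
    have e1 : (FramedRep.toRepresentation ρ h :
        (Fin n → PadicAlgCl ℓ) →ₗ[PadicAlgCl ℓ] (Fin n → PadicAlgCl ℓ)) =
        Matrix.toLin' ((ρ h : GL (Fin n) (PadicAlgCl ℓ)) : Matrix (Fin n) (Fin n) (PadicAlgCl ℓ)) :=
      LinearMap.ext fun w => by simp
    rw [e1, Matrix.charpoly_toLin']
    rfl
  have hmem : τ ∈ Literature.NumberTheory.Automorphic.charpolyKer (FramedRep.toRepresentation ρ) := by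
    rw [Literature.NumberTheory.Automorphic.mem_charpolyKer_iff]
    intro g
    rw [e, e, hcharpoly]
  have h1 := Literature.NumberTheory.Automorphic.apply_eq_one_of_mem_charpolyKer hss hmem
  have h2 : Matrix.toLin' ((ρ τ : GL (Fin n) (PadicAlgCl ℓ)) : Matrix (Fin n) (Fin n) (PadicAlgCl ℓ)) =
      Matrix.toLin' 1 := by
    rw [Matrix.toLin'_one]
    refine LinearMap.ext fun w => ?_
    have hw := congr($h1 w)
    simpa using hw
  exact Units.ext (Matrix.toLin'.injective h2)

/-- **Stub S1 — Taylor's `ℓ`-adic limit in TRACE form**, the closed `∀`-form registered in the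
skeleton of the line `slope-free-polarized-limit` (by `exact` on
`exists_semisimple_framedRep_of_traceLimit`). -/
theorem stub_traceLimit :
    ∀ (G : Type) [Group G] [TopologicalSpace G] [IsTopologicalGroup G] (ℓ : ℕ) [Fact ℓ.Prime] (n : ℕ)
      (E : IntermediateField ℚ_[ℓ] (PadicAlgCl ℓ)) [FiniteDimensional ℚ_[ℓ] E]
      (D : Set G), Dense D → ∀ (t : G → PadicAlgCl ℓ), (∀ g ∈ D, t g ∈ E) →
      ∀ (I : Set G) (ρ' : ℕ → FramedRep G (PadicAlgCl ℓ) n),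
      (∀ m : ℕ, ∀ τ ∈ I, ρ' m τ = 1) →
      (∀ m : ℕ, ∀ g ∈ D, ‖FramedRep.trace (ρ' m) g - t g‖ ≤ (ℓ : ℝ) ^ (-(m : ℤ))) →
      ∃ ρ : FramedRep G (PadicAlgCl ℓ) n,
        (FramedRep.toRepresentation ρ).IsSemisimpleRepresentation ∧
        (∀ τ ∈ I, ρ τ = 1) ∧
        (∀ (m : ℕ) (g : G), ‖FramedRep.trace (ρ' m) g - FramedRep.trace ρ g‖ ≤ (ℓ : ℝ) ^ (-(m : ℤ))) ∧
        (∀ g : G, FramedRep.trace ρ g ∈ E) :=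
  fun _G _ _ _ _ℓ _ n E _ _D hD t ht I ρ' hI happ =>
    exists_semisimple_framedRep_of_traceLimit n E hD t ht I ρ' hI happ

end

end Summit.Langlands.Langlands.Theorems.IrregularClassicality.SlopeFreePolarizedLimit
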